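import Mathlib
import Summits.ValiantsHypothesis.ValiantsHypothesis.Theorems.LiouvilleSarnakDigitalBilinearLiouvilleRectanglesLowRows

/-!
# Route LiouvilleSarnak — crux `DigitalBilinearLiouville` (stmt-ValiantsHypothesis-14774) in rectangle
# currency: ANY ROWS × FULL COLUMNS for every cut whose lowest digits are column digits

The transposed companion of `Theorems/LiouvilleSarnakDigitalBilinearLiouvilleRectanglesLowRows.lean`
(`rectangles_fullRows_of_lowRows`: if the rows own the lowest `L(ε)` bit positions, then
`|Σ_r Σ_{c ∈ B} λ(N_π(r,c)+1)| ≤ ε 4^n` for every `B`).  Exchanging the roles of rows and columns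
(the cut `π ∘ Sum.swap`, whose cut number at `(c, r)` is `N_π(r, c)`):

* ★ `rectangles_fullCols_of_lowCols`: for every `ε > 0` there is `L` such that for every cut `π` whose
  positions `0, …, L-1` are COLUMN bits and every set `A ⊆ {0,1}^n` of row digit strings,
  `|Σ_{r ∈ A} Σ_{c} λ(N_π(r, c) + 1)| ≤ ε · 4^n`.

So whichever letter owns the lowest `L(ε)` digits of a cut, that letter's one-sided rectangle family
holds unconditionally (Matomäki–Radziwiłł); the two-sided statement — the crux — and the one-sided
family of the OTHER letter (for the aligned cut: `AlignedTypeI`, stmt-21040) remain open.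

Honest framing: a corollary by symmetry; `DigitalBilinearLiouville`, `LiouvilleCutRank`, `AlignedTypeI`
and `AlgebraicSarnak` stay OPEN, and nothing here bears on VP versus VNP.  No definitions.
[cite: MatomakiRadziwillAnnals2016, Theorem 1]
-/

-- the directory `ValiantsHypothesis/ValiantsHypothesis` repeats the summit name (tree layout)
set_option linter.dupNamespace false

namespace Summit.ValiantsHypothesis.ValiantsHypothesis.Theorems.LiouvilleSarnakDigitalBilinearLiouville.Rectangles

open Finset ArithmeticFunction

/-- The cut with rows and columns exchanged has the transposed cut number. [folklore] -/
theorem cutNumber_swap (n : ℕ) (π : Fin n ⊕ Fin n ≃ Fin (2 * n)) (r c : Fin n → Bool) :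
    Nat.ofBits (fun j : Fin (2 * n) =>
        Sum.elim c r (((Equiv.sumComm (Fin n) (Fin n)).trans π).symm j)) =
      Nat.ofBits (fun j : Fin (2 * n) => Sum.elim r c (π.symm j)) := by
  congr 1
  funext j
  rw [Equiv.symm_trans_apply, Equiv.sumComm_symm, Equiv.sumComm_apply]
  rcases π.symm j with i | i <;> rfl

/-- ★ **Any rows × full columns, for every cut whose lowest `L(ε)` positions are column bits.**  For
every `ε > 0` there is `L` such that for every `n`, every balanced cut `π` of the `2n` bit positions with
`(π.symm j).isRight` for all `j < L` (and `L ≤ 2n`), and every set `A` of row digit strings,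
`|Σ_{r ∈ A} Σ_{c} λ(N_π(r, c) + 1)| ≤ ε · 4^n` (apply `rectangles_fullRows_of_lowRows` to the cut with
rows and columns exchanged). [cite: MatomakiRadziwillAnnals2016, Theorem 1] -/
theorem rectangles_fullCols_of_lowCols :
    ∀ ε : ℝ, 0 < ε → ∃ L : ℕ, ∀ n : ℕ, ∀ π : Fin n ⊕ Fin n ≃ Fin (2 * n), L ≤ 2 * n →
      (∀ j : Fin (2 * n), (j : ℕ) < L → (π.symm j).isRight = true) →
      ∀ A : Finset (Fin n → Bool),
        |∑ r ∈ A, ∑ c : Fin n → Bool, ((liouville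
          (Nat.ofBits (fun j : Fin (2 * n) => Sum.elim r c (π.symm j)) + 1) : ℤ) : ℝ)| ≤
          ε * 4 ^ n := by
  intro ε hε
  obtain ⟨L, hL⟩ := rectangles_fullRows_of_lowRows ε hε
  refine ⟨L, fun n π hLn hcol A => ?_⟩
  set π' : Fin n ⊕ Fin n ≃ Fin (2 * n) := (Equiv.sumComm (Fin n) (Fin n)).trans π with hπ'
  have hrow' : ∀ j : Fin (2 * n), (j : ℕ) < L → (π'.symm j).isLeft = true := by
    intro j hj
    rw [hπ', Equiv.symm_trans_apply, Equiv.sumComm_symm, Equiv.sumComm_apply, Sum.isLeft_swap]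
    exact hcol j hj
  have key := hL n π' hLn hrow' A
  rw [Finset.sum_comm]
  have hentry : ∀ r c : Fin n → Bool,
      ((liouville (Nat.ofBits (fun j : Fin (2 * n) => Sum.elim r c (π.symm j)) + 1) : ℤ) : ℝ) =
      ((liouville (Nat.ofBits (fun j : Fin (2 * n) => Sum.elim c r (π'.symm j)) + 1) : ℤ) : ℝ) := by
    intro r c
    rw [hπ', cutNumber_swap]
  simp_rw [hentry]
  exact key

end Summit.ValiantsHypothesis.ValiantsHypothesis.Theorems.LiouvilleSarnakDigitalBilinearLiouville.Rectangles
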